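import Summits.QuantumFields.YangMills.Theorems.BalabanUVNodesN15KingModelInfiniteVolumeField
import Mathlib.Analysis.Matrix.Order

/-!
# BalabanUVNodes ∕ N15 — THE KING-MODEL RUNG (PART Ϻ-o): REFLECTION POSITIVITY OF THE LAW `μ_∞` ON THE EXPONENTIAL ALGEBRA —
# `∫ θF·F dμ_∞ ≥ 0` for `F = Σ_k a_k exp(φ(f_k))`, `f_k` supported in the half-lattice `{z_ν ≥ 0}`, `θ` the block reflection `z ↦ (z_⊥, −z_ν−1)`
# (Gaussian exponential moments + covariance reflection positivity (part Ϸ-k) + the Schur product theorem)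
# (Track A, DAG node N15 = NE2; FAN-OUT v1.1 §N15 s3 «KING-MODEL RUNG»; uses parts Ϻ-n (`μ_∞`), Ϸ-k, Ϝ-m; count-neutral)

HONEST FRAMING.  Count-neutral (cell `pub-ymgap`, seat `pub-ymgap-dag-n15-e` g35; `--supports stmt-QuantumFields-27366 --as helper` = K3⁸).  King's `A = 0`, `g = 0` model
([King1986] C. King, Commun. Math. Phys. **102** (1986) 649–677).  Part Ϻ-n built the infinite-volume continuum block field `μ_∞` (a centred Gaussian probability measure on
`ℝ^{ℤ^{d+1}}` with covariance `S₂^{ℝ}(w−z)`) and read part Ϸ-k's covariance reflection positivity on LINEAR observables.  THIS FILE proves REFLECTION POSITIVITY OF THE LAW on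
the EXPONENTIAL algebra (the classical route, Glimm–Jaffe Thm 6.2.2): for finitely supported real test functions `f_k` on the half-lattice `Λ₊ = {z : z_ν ≥ 0}` (support
`s ⊆ Λ₊`), field sums `φ(f) = Σ_{z∈s} f(z)φ(z)`, the block reflection `θz = (z_⊥, −z_ν−1)` and `F = Σ_k a_k e^{φ(f_k)}`, `θF = Σ_k a_k e^{φ_θ(f_k)}` with
`φ_θ(f) = Σ_{z∈s}f(z)φ(θz)`:  ★★★ `∫ θF·F dμ_∞ ≥ 0`.  PROOF: Gaussian exponential moments `∫e^{Y}dμ_∞ = e^{Var Y∕2}` for the centred Gaussian `Y = φ_θ(f_k) + φ(f_l)`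
(Mathlib `IsGaussianProcess` ∕ `HasGaussianLaw.map_eq_gaussianReal` ∕ `mgf_gaussianReal`); expanding the variance and using the reflection ∕ evenness symmetries of `S₂^{ℝ}`
(part Ϝ-m) gives `∫θF·F = Σ_{k,l} b_k b_l e^{M_{kl}}` with `b_k = a_k e^{V_k∕2}`, `V_k = Σ f_k f_k S₂^{ℝ}`, `M_{kl} = Σ_{z,w} f_k(z)f_l(w)S₂^{ℝ}(w − θz)`; `M` is symmetric positive
semidefinite by part Ϸ-k's covariance reflection positivity, hence so is its ENTRYWISE EXPONENTIAL (Hadamard powers by Mathlib's Schur product theorem `Matrix.PosSemidef.hadamard`,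
summed as a series), whence the claim.  (Complex exponentials ∕ polynomials and the OS reconstruction of a transfer operator are NOT typed here.)  NOT Bałaban's objects; NOT a node
discharge; nothing continuum-Yang–Mills ∕ `ℝ⁴` ∕ Clay — the RP of a FREE lattice-indexed Gaussian field under a block reflection.  0 `sorry`, 0 def; standard axioms.

WHAT THIS FILE PROVES (kernel).  §1 `posSemidef_hadamardPow`, `quadForm_entrywiseExp_eq_tsum`, ★★ **`posSemidef_entrywiseExp`** (entrywise `exp` of a PSD real matrix is PSD).  §2 `hasGaussianLaw_fieldSum`,
`integral_fieldSum`, `variance_fieldSum`, ★★ **`integral_exp_fieldSum`** (`∫e^{Σ_j c_jφ(p_j)}dμ_∞ = exp(½Σ_{j,j′}c_jc_{j′}S₂^{ℝ}(p_{j′}−p_j))`), `integrable_exp_fieldSum`.  §3 `reflect_sub_reflect`,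
`sub_reflect_symm`, `kingS2Inf_reflect_sub_reflect`, `kingS2Inf_sub_reflect_symm`, ★ `posSemidef_reflectGram` (the matrix `M`), ★★★ **`kingFieldInf_reflection_positive_exp`**.

HONEST SCOPE.  King's free model, `m² > 0`, every `d`; observables = finite real-exponential sums of finitely supported field sums.  N15 untouched; counts unmoved.  Locators (use):
[King1986] Thm 2.1 (2.22) p.654, Thm 3.3 (3.6) p.655; [GlimmJaffe1987] Thm 6.2.2.
-/

noncomputable section

open scoped BigOperators Topology Matrix
open Filter MeasureTheory ProbabilityTheory Finset

namespace Summit.QuantumFields.YangMills.BalabanUVNodes.N15KingModelRung.InfiniteVolume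

open Literature.MathematicalPhysics.QuantumFieldTheory (IsPosSemidefKernel gaussianFieldOfKernel isGaussianProcess_eval_gaussianFieldOfKernel
  integral_eval_gaussianFieldOfKernel covariance_eval_gaussianFieldOfKernel)
open Summit.QuantumFields.YangMills.BalabanUVNodes.N15KingModelRung.OptimalDecay

variable {d : ℕ}

/-! ## §1 The entrywise exponential of a positive-semidefinite real matrix is positive semidefinite -/

section Schur

variable {n : Type*} [Fintype n]

/-- Hadamard powers of a PSD real matrix are PSD (Schur product theorem, iterated; the zeroth power is the all-ones matrix `1·1ᵀ`). [folklore] -/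
theorem posSemidef_hadamardPow {M : Matrix n n ℝ} (hM : M.PosSemidef) (m : ℕ) : (Matrix.of fun j k => M j k ^ m).PosSemidef := by
  induction m with
  | zero =>
    have h1 : (Matrix.of fun j k : n => M j k ^ 0) = Matrix.vecMulVec (fun _ : n => (1 : ℝ)) (star fun _ : n => (1 : ℝ)) := by
      ext j k; simp [Matrix.vecMulVec_apply]
    rw [h1]
    exact Matrix.posSemidef_vecMulVec_self_star _
  | succ m ih =>
    have h1 : (Matrix.of fun j k : n => M j k ^ (m + 1)) = M ⊙ Matrix.of fun j k => M j k ^ m := by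
      ext j k; simp [Matrix.hadamard_apply, pow_succ, mul_comm]
    rw [h1]
    exact hM.hadamard ih

/-- The quadratic form of the entrywise exponential as a series of Hadamard-power quadratic forms. [folklore] -/
theorem quadForm_entrywiseExp_eq_tsum (M : Matrix n n ℝ) (c : n → ℝ) :
    ∑ j, ∑ k, c j * Real.exp (M j k) * c k = ∑' m : ℕ, ∑ j, ∑ k, c j * (M j k ^ m / m.factorial) * c k := by
  have hsum : ∀ j k, HasSum (fun m : ℕ => c j * (M j k ^ m / m.factorial) * c k) (c j * Real.exp (M j k) * c k) := by
    intro j k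
    have h := (Real.summable_pow_div_factorial (M j k)).hasSum
    have hv : ∑' m : ℕ, M j k ^ m / m.factorial = Real.exp (M j k) := by
      rw [Real.exp_eq_exp_ℝ, NormedSpace.exp_eq_tsum_div]
    rw [hv] at h
    exact (h.mul_left (c j)).mul_right (c k)
  have h2 : ∀ j, HasSum (fun m : ℕ => ∑ k, c j * (M j k ^ m / m.factorial) * c k) (∑ k, c j * Real.exp (M j k) * c k) := fun j =>
    hasSum_sum fun k _ => hsum j k
  have h3 : HasSum (fun m : ℕ => ∑ j, ∑ k, c j * (M j k ^ m / m.factorial) * c k) (∑ j, ∑ k, c j * Real.exp (M j k) * c k) := hasSum_sum fun j _ => h2 j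
  exact h3.tsum_eq.symm

/-- ★★ **THE ENTRYWISE EXPONENTIAL OF A PSD REAL MATRIX IS PSD** (`(e^{M_{jk}})_{jk} = Σ_m M^{⊙m}∕m!`, each Hadamard power PSD by Schur). [folklore; GlimmJaffe1987, Thm 6.2.2 (proof)] -/
theorem posSemidef_entrywiseExp {M : Matrix n n ℝ} (hM : M.PosSemidef) : (Matrix.of fun j k => Real.exp (M j k)).PosSemidef := by
  refine Matrix.PosSemidef.of_dotProduct_mulVec_nonneg ?_ fun c => ?_
  · ext j k
    simp only [Matrix.conjTranspose_apply, Matrix.of_apply, star_trivial]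
    rw [hM.isHermitian.apply j k |>.symm, star_trivial]
  · have e : star c ⬝ᵥ (Matrix.of (fun j k => Real.exp (M j k))).mulVec c = ∑ j, ∑ k, c j * Real.exp (M j k) * c k := by
      simp only [star_trivial, dotProduct, Matrix.mulVec, Matrix.of_apply, Finset.mul_sum]
      refine Finset.sum_congr rfl fun j _ => Finset.sum_congr rfl fun k _ => ?_
      ring
    rw [e, quadForm_entrywiseExp_eq_tsum]
    refine tsum_nonneg fun m => ?_
    have hm := (posSemidef_hadamardPow hM m).dotProduct_mulVec_nonneg c
    have e2 : star c ⬝ᵥ (Matrix.of (fun j k => M j k ^ m)).mulVec c = ∑ j, ∑ k, c j * M j k ^ m * c k := by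
      simp only [star_trivial, dotProduct, Matrix.mulVec, Matrix.of_apply, Finset.mul_sum]
      refine Finset.sum_congr rfl fun j _ => Finset.sum_congr rfl fun k _ => ?_
      ring
    rw [e2] at hm
    have e3 : ∑ j, ∑ k, c j * (M j k ^ m / m.factorial) * c k = (m.factorial : ℝ)⁻¹ * ∑ j, ∑ k, c j * M j k ^ m * c k := by
      rw [Finset.mul_sum]
      refine Finset.sum_congr rfl fun j _ => ?_
      rw [Finset.mul_sum]
      refine Finset.sum_congr rfl fun k _ => ?_
      field_simp
    rw [e3]
    exact mul_nonneg (by positivity) hm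

end Schur

/-! ## §2 Exponential moments of field sums under `μ_∞` -/

section Moments

variable {J : Type*}

/-- A finite field sum `Y = Σ_{j∈T} c_j φ(p_j)` has Gaussian law under `μ_∞`. [folklore] -/
theorem hasGaussianLaw_fieldSum {m2 : ℝ} (hm : 0 < m2) (T : Finset J) (p : J → Fin (d + 1) → ℤ) (c : J → ℝ) :
    HasGaussianLaw (fun ω : (Fin (d + 1) → ℤ) → ℝ => ∑ j ∈ T, c j * ω (p j)) (kingFieldInf m2) := by
  have hG : IsGaussianProcess (fun (s : Fin (d + 1) → ℤ) (ω : (Fin (d + 1) → ℤ) → ℝ) => ω s) (kingFieldInf (d := d) m2) :=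
    isGaussianProcess_eval_gaussianFieldOfKernel (isPosSemidefKernel_kingKernel (d := d) hm)
  have h := ((hG.comp_right p).smul c).hasGaussianLaw_fun_sum (I := T)
  have hfun : (fun ω : (Fin (d + 1) → ℤ) → ℝ => ∑ j ∈ T, c j • ((fun (s : Fin (d + 1) → ℤ) (ω' : (Fin (d + 1) → ℤ) → ℝ) => ω' s) ∘ p) j ω)
      = fun ω => ∑ j ∈ T, c j * ω (p j) := by
    funext ω
    simp only [Function.comp, smul_eq_mul]
  rw [hfun] at h
  exact h

/-- `∫ Σ_{j∈T} c_jφ(p_j) dμ_∞ = 0`. [folklore] -/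
theorem integral_fieldSum {m2 : ℝ} (hm : 0 < m2) (T : Finset J) (p : J → Fin (d + 1) → ℤ) (c : J → ℝ) :
    ∫ ω, (∑ j ∈ T, c j * ω (p j)) ∂kingFieldInf m2 = 0 := by
  have hG : IsGaussianProcess (fun (s : Fin (d + 1) → ℤ) (ω : (Fin (d + 1) → ℤ) → ℝ) => ω s) (kingFieldInf (d := d) m2) :=
    isGaussianProcess_eval_gaussianFieldOfKernel (isPosSemidefKernel_kingKernel (d := d) hm)
  have hI : ∀ j ∈ T, Integrable (fun ω : (Fin (d + 1) → ℤ) → ℝ => c j * ω (p j)) (kingFieldInf m2) := fun j _ =>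
    ((hG.hasGaussianLaw_eval (p j)).integrable).const_mul (c j)
  rw [integral_finsetSum _ hI]
  refine Finset.sum_eq_zero fun j _ => ?_
  rw [integral_const_mul]
  change c j * ∫ ω, ω (p j) ∂kingFieldInf m2 = 0
  rw [integral_eval_kingFieldInf hm, mul_zero]

/-- `Var[Σ_{j∈T} c_jφ(p_j); μ_∞] = Σ_{j,j′∈T} c_j c_{j′} S₂^{ℝ}(p_{j′} − p_j)`. [folklore] -/
theorem variance_fieldSum {m2 : ℝ} (hm : 0 < m2) (T : Finset J) (p : J → Fin (d + 1) → ℤ) (c : J → ℝ) :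
    Var[fun ω : (Fin (d + 1) → ℤ) → ℝ => ∑ j ∈ T, c j * ω (p j); kingFieldInf m2] = ∑ j ∈ T, ∑ j' ∈ T, c j * c j' * kingS2Inf m2 (p j' - p j) := by
  haveI := isProbabilityMeasure_kingFieldInf (d := d) hm
  have hK := isPosSemidefKernel_kingKernel (d := d) hm
  have hG : IsGaussianProcess (fun (s : Fin (d + 1) → ℤ) (ω : (Fin (d + 1) → ℤ) → ℝ) => ω s) (kingFieldInf (d := d) m2) :=
    isGaussianProcess_eval_gaussianFieldOfKernel hK
  have hL2 : ∀ j ∈ T, MemLp (fun ω : (Fin (d + 1) → ℤ) → ℝ => c j * ω (p j)) 2 (kingFieldInf m2) := fun j _ =>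
    ((hG.hasGaussianLaw_eval (p j)).memLp_two).const_mul (c j)
  have h := variance_fun_sum' (μ := kingFieldInf m2) hL2
  rw [h]
  refine Finset.sum_congr rfl fun j _ => Finset.sum_congr rfl fun j' _ => ?_
  rw [covariance_const_mul_left, covariance_const_mul_right]
  have hc : cov[fun ω : (Fin (d + 1) → ℤ) → ℝ => ω (p j), fun ω => ω (p j'); kingFieldInf m2] = kingS2Inf m2 (p j' - p j) :=
    covariance_eval_gaussianFieldOfKernel hK (p j) (p j')
  rw [hc]
  ring

/-- ★★ **EXPONENTIAL MOMENTS**: `∫ exp(Σ_{j∈T} c_jφ(p_j)) dμ_∞ = exp(½ Σ_{j,j′∈T} c_j c_{j′} S₂^{ℝ}(p_{j′} − p_j))` (Gaussian MGF at `t = 1`). [folklore] -/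
theorem integral_exp_fieldSum {m2 : ℝ} (hm : 0 < m2) (T : Finset J) (p : J → Fin (d + 1) → ℤ) (c : J → ℝ) :
    ∫ ω, Real.exp (∑ j ∈ T, c j * ω (p j)) ∂kingFieldInf m2 = Real.exp ((∑ j ∈ T, ∑ j' ∈ T, c j * c j' * kingS2Inf m2 (p j' - p j)) / 2) := by
  haveI := isProbabilityMeasure_kingFieldInf (d := d) hm
  have hlaw := (hasGaussianLaw_fieldSum hm T p c).map_eq_gaussianReal
  have hmgf := mgf_gaussianReal hlaw 1
  rw [mgf] at hmgf
  simp only [one_mul, one_pow, mul_one] at hmgf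
  rw [hmgf, integral_fieldSum hm T p c, zero_add, Real.coe_toNNReal _ (variance_nonneg _ _), variance_fieldSum hm T p c]

/-- `exp(Σ_{j∈T} c_jφ(p_j))` is `μ_∞`-integrable. [folklore] -/
theorem integrable_exp_fieldSum {m2 : ℝ} (hm : 0 < m2) (T : Finset J) (p : J → Fin (d + 1) → ℤ) (c : J → ℝ) :
    Integrable (fun ω : (Fin (d + 1) → ℤ) → ℝ => Real.exp (∑ j ∈ T, c j * ω (p j))) (kingFieldInf m2) := by
  have hY := hasGaussianLaw_fieldSum hm T p c
  have hlaw := hY.map_eq_gaussianReal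
  have h1 : Integrable (fun y : ℝ => Real.exp y) ((kingFieldInf m2).map fun ω : (Fin (d + 1) → ℤ) → ℝ => ∑ j ∈ T, c j * ω (p j)) := by
    rw [hlaw]
    have := integrable_exp_mul_gaussianReal (μ := ∫ ω, (∑ j ∈ T, c j * ω (p j)) ∂kingFieldInf m2)
      (v := (Var[fun ω : (Fin (d + 1) → ℤ) → ℝ => ∑ j ∈ T, c j * ω (p j); kingFieldInf m2]).toNNReal) 1
    simpa only [one_mul] using this
  exact (integrable_map_measure h1.aestronglyMeasurable hY.aemeasurable).mp h1

end Moments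

/-! ## §3 Reflection positivity of `μ_∞` on the exponential algebra -/

section RP

variable (ν : Fin (d + 1))

/-- `θz − θw` is the `ν`-th coordinate reflection of `z − w` (`θz = (z_⊥, −z_ν−1)`). [folklore] -/
theorem reflect_sub_reflect (z w : Fin (d + 1) → ℤ) :
    Function.update z ν (-(z ν) - 1) - Function.update w ν (-(w ν) - 1) = latReflIdx ν (z - w) := by
  funext μ
  by_cases h : μ = ν
  · subst h; simp [latReflIdx]; ring
  · simp [latReflIdx, h]

/-- `z − θw = −R_ν(w − θz)`: the two off-diagonal displacements are related by the reflection of all coordinates but `ν`. [folklore] -/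
theorem sub_reflect_symm (z w : Fin (d + 1) → ℤ) :
    z - Function.update w ν (-(w ν) - 1) = -(latReflIdx ν (w - Function.update z ν (-(z ν) - 1))) := by
  funext μ
  by_cases h : μ = ν
  · subst h; simp [latReflIdx]; ring
  · simp [latReflIdx, h]

/-- `S₂^{ℝ}(θz − θw) = S₂^{ℝ}(z − w)`. [cite: King1986, Thm 2.1 (2.22) p.654] -/
theorem kingS2Inf_reflect_sub_reflect (m2 : ℝ) (z w : Fin (d + 1) → ℤ) :
    kingS2Inf m2 (Function.update z ν (-(z ν) - 1) - Function.update w ν (-(w ν) - 1)) = kingS2Inf m2 (z - w) := by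
  rw [reflect_sub_reflect, kingS2Inf_refl]

/-- `S₂^{ℝ}(z − θw) = S₂^{ℝ}(w − θz)` (symmetry of the reflected Gram matrix). [cite: King1986, Thm 2.1 (2.22) p.654] -/
theorem kingS2Inf_sub_reflect_symm (m2 : ℝ) (z w : Fin (d + 1) → ℤ) :
    kingS2Inf m2 (z - Function.update w ν (-(w ν) - 1)) = kingS2Inf m2 (w - Function.update z ν (-(z ν) - 1)) := by
  rw [sub_reflect_symm, kingS2Inf_neg, kingS2Inf_refl]

variable {ι : Type*} [Fintype ι]

/-- ★ **The reflected Gram matrix is positive semidefinite**: for test functions `f_k` supported in `s ⊆ {z_ν ≥ 0}`,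
`M_{kl} = Σ_{z,w∈s} f_k(z)f_l(w)S₂^{ℝ}(w − θz)` is symmetric PSD (part Ϸ-k's covariance reflection positivity on the index set `ι × s`). [cite: King1986, Thm 3.3 (3.6) p.655, Thm 2.1 (2.22) p.654] -/
theorem posSemidef_reflectGram {m2 : ℝ} (hm : 0 < m2) (s : Finset (Fin (d + 1) → ℤ)) (hs : ∀ z ∈ s, 0 ≤ z ν) (f : ι → (Fin (d + 1) → ℤ) → ℝ) :
    (Matrix.of fun k l : ι => ∑ z ∈ s, ∑ w ∈ s, f k z * f l w * kingS2Inf m2 (w - Function.update z ν (-(z ν) - 1))).PosSemidef := by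
  refine Matrix.PosSemidef.of_dotProduct_mulVec_nonneg ?_ fun x => ?_
  · ext k l
    simp only [Matrix.conjTranspose_apply, Matrix.of_apply, star_trivial]
    rw [Finset.sum_comm]
    refine Finset.sum_congr rfl fun z _ => Finset.sum_congr rfl fun w _ => ?_
    rw [kingS2Inf_sub_reflect_symm]
    ring
  · -- the quadratic form is part Ϸ-k's with index set `ι × sites`, coefficients `x_k f_k(z)`, sites `z`
    have h := kingS2Inf_reflection_positive hm ν ((Finset.univ : Finset ι) ×ˢ s) (fun q : ι × (Fin (d + 1) → ℤ) => x q.1 * f q.1 q.2)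
      (fun q : ι × (Fin (d + 1) → ℤ) => q.2) (fun q hq => hs q.2 (Finset.mem_product.mp hq).2)
    simp_rw [Finset.sum_product] at h
    have e : star x ⬝ᵥ (Matrix.of (fun k l : ι => ∑ z ∈ s, ∑ w ∈ s, f k z * f l w * kingS2Inf m2 (w - Function.update z ν (-(z ν) - 1)))).mulVec x
        = ∑ k, ∑ l, ∑ z ∈ s, ∑ w ∈ s,
            x k * f k z * (x l * f l w) * kingS2Inf m2 (Function.update z ν (-(z ν) - 1) - w) := by
      simp only [star_trivial, dotProduct, Matrix.mulVec, Matrix.of_apply, Finset.mul_sum, Finset.sum_mul]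
      refine Finset.sum_congr rfl fun k _ => Finset.sum_congr rfl fun l _ => Finset.sum_congr rfl fun z _ => Finset.sum_congr rfl fun w _ => ?_
      rw [← kingS2Inf_neg m2 (Function.update z ν (-(z ν) - 1) - w), neg_sub]
      ring
    rw [e]
    refine le_trans h (le_of_eq (Finset.sum_congr rfl fun k _ => Finset.sum_comm))

/-- ★★★ **REFLECTION POSITIVITY OF THE LAW `μ_∞` ON THE EXPONENTIAL ALGEBRA**: let `ν` be a coordinate, `θz = (z_⊥, −z_ν − 1)` the block reflection, `s` a finite set of sites in the
half-lattice `{z_ν ≥ 0}`, `f_k : s`-supported real test functions and `a_k` real coefficients (`k` in a finite type).  With `F(φ) = Σ_k a_k exp(Σ_{z∈s} f_k(z)φ(z))` and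
`θF(φ) = Σ_k a_k exp(Σ_{z∈s} f_k(z)φ(θz))`:  `0 ≤ ∫ θF·F dμ_∞`. [cite: King1986, Thm 2.1 (2.22) p.654, Thm 3.3 (3.6) p.655; GlimmJaffe1987, Thm 6.2.2] -/
theorem kingFieldInf_reflection_positive_exp {m2 : ℝ} (hm : 0 < m2) (s : Finset (Fin (d + 1) → ℤ)) (hs : ∀ z ∈ s, 0 ≤ z ν) (f : ι → (Fin (d + 1) → ℤ) → ℝ) (a : ι → ℝ) :
    0 ≤ ∫ ω, (∑ k, a k * Real.exp (∑ z ∈ s, f k z * ω (Function.update z ν (-(z ν) - 1)))) * (∑ l, a l * Real.exp (∑ z ∈ s, f l z * ω z)) ∂kingFieldInf m2 := by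
  -- abbreviations
  set θ : (Fin (d + 1) → ℤ) → (Fin (d + 1) → ℤ) := fun z => Function.update z ν (-(z ν) - 1) with hθ
  set V : ι → ℝ := fun k => ∑ z ∈ s, ∑ w ∈ s, f k z * f k w * kingS2Inf m2 (w - z) with hV
  set M : Matrix ι ι ℝ := Matrix.of fun k l => ∑ z ∈ s, ∑ w ∈ s, f k z * f l w * kingS2Inf m2 (w - θ z) with hM
  -- Step 1: each cross term is an exponential moment of ONE field sum over `Bool × sites`
  have hterm : ∀ k l, ∫ ω, Real.exp (∑ z ∈ s, f k z * ω (θ z)) * Real.exp (∑ z ∈ s, f l z * ω z) ∂kingFieldInf m2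
      = Real.exp (V k / 2) * Real.exp (V l / 2) * Real.exp (M k l) := by
    intro k l
    -- the combined field sum
    set p : Bool × (Fin (d + 1) → ℤ) → (Fin (d + 1) → ℤ) := fun q => if q.1 then θ q.2 else q.2 with hp
    set c : Bool × (Fin (d + 1) → ℤ) → ℝ := fun q => if q.1 then f k q.2 else f l q.2 with hc
    have hsplit : ∀ ω : (Fin (d + 1) → ℤ) → ℝ, ∑ q ∈ Finset.univ ×ˢ s, c q * ω (p q) = (∑ z ∈ s, f k z * ω (θ z)) + ∑ z ∈ s, f l z * ω z := by
      intro ω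
      rw [Finset.sum_product, Fintype.sum_bool]
      simp [hp, hc]
    have hexp : (fun ω : (Fin (d + 1) → ℤ) → ℝ => Real.exp (∑ z ∈ s, f k z * ω (θ z)) * Real.exp (∑ z ∈ s, f l z * ω z))
        = fun ω => Real.exp (∑ q ∈ Finset.univ ×ˢ s, c q * ω (p q)) := by
      funext ω; rw [hsplit, Real.exp_add]
    rw [hexp, integral_exp_fieldSum hm, ← Real.exp_add, ← Real.exp_add]
    congr 1
    -- the variance of the combined sum: four blocks
    rw [Finset.sum_product, Fintype.sum_bool]
    simp only [Finset.sum_product, Fintype.sum_bool, hp, hc, if_true, Bool.false_eq_true, if_false, Finset.sum_add_distrib]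
    have hAA : ∑ z ∈ s, ∑ w ∈ s, f k z * f k w * kingS2Inf m2 (θ w - θ z) = V k := by
      refine Finset.sum_congr rfl fun z _ => Finset.sum_congr rfl fun w _ => ?_
      rw [hθ, kingS2Inf_reflect_sub_reflect]
    have hAB : ∑ z ∈ s, ∑ w ∈ s, f k z * f l w * kingS2Inf m2 (w - θ z) = M k l := by rw [hM]; rfl
    have hBA : ∑ z ∈ s, ∑ w ∈ s, f l z * f k w * kingS2Inf m2 (θ w - z) = M k l := by
      rw [hM, Matrix.of_apply, Finset.sum_comm]
      refine Finset.sum_congr rfl fun z _ => Finset.sum_congr rfl fun w _ => ?_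
      rw [← kingS2Inf_neg m2 (θ z - w), neg_sub]
      ring
    have hBB : ∑ z ∈ s, ∑ w ∈ s, f l z * f l w * kingS2Inf m2 (w - z) = V l := rfl
    rw [hAA, hAB, hBA, hBB]
    ring
  -- Step 2: expand the product of sums and integrate termwise
  have hint : ∀ k l, Integrable (fun ω : (Fin (d + 1) → ℤ) → ℝ => a k * Real.exp (∑ z ∈ s, f k z * ω (θ z)) * (a l * Real.exp (∑ z ∈ s, f l z * ω z))) (kingFieldInf m2) := by
    intro k l
    set p : Bool × (Fin (d + 1) → ℤ) → (Fin (d + 1) → ℤ) := fun q => if q.1 then θ q.2 else q.2 with hp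
    set c : Bool × (Fin (d + 1) → ℤ) → ℝ := fun q => if q.1 then f k q.2 else f l q.2 with hc
    have hI := (integrable_exp_fieldSum hm (Finset.univ ×ˢ s) p c).const_mul (a k * a l)
    refine hI.congr (Eventually.of_forall fun ω => ?_)
    simp only
    rw [Finset.sum_product, Fintype.sum_bool]
    simp only [hp, hc, if_true, Bool.false_eq_true, if_false, Real.exp_add]
    ring
  have hexp : (fun ω : (Fin (d + 1) → ℤ) → ℝ => (∑ k, a k * Real.exp (∑ z ∈ s, f k z * ω (θ z))) * (∑ l, a l * Real.exp (∑ z ∈ s, f l z * ω z)))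
      = fun ω => ∑ k, ∑ l, a k * Real.exp (∑ z ∈ s, f k z * ω (θ z)) * (a l * Real.exp (∑ z ∈ s, f l z * ω z)) := by
    funext ω; rw [Finset.sum_mul_sum]
  rw [hexp, integral_finsetSum _ fun k _ => integrable_finsetSum _ fun l _ => hint k l]
  simp_rw [integral_finsetSum _ fun l _ => hint _ l]
  have hkl : ∀ k l, ∫ ω, a k * Real.exp (∑ z ∈ s, f k z * ω (θ z)) * (a l * Real.exp (∑ z ∈ s, f l z * ω z)) ∂kingFieldInf m2
      = (a k * Real.exp (V k / 2)) * Real.exp (M k l) * (a l * Real.exp (V l / 2)) := by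
    intro k l
    have e : (fun ω : (Fin (d + 1) → ℤ) → ℝ => a k * Real.exp (∑ z ∈ s, f k z * ω (θ z)) * (a l * Real.exp (∑ z ∈ s, f l z * ω z)))
        = fun ω => (a k * a l) * (Real.exp (∑ z ∈ s, f k z * ω (θ z)) * Real.exp (∑ z ∈ s, f l z * ω z)) := by
      funext ω; ring
    rw [e, integral_const_mul, hterm]
    ring
  simp_rw [hkl]
  -- Step 3: the quadratic form of the entrywise exponential of the PSD matrix `M`
  have hPSD : (Matrix.of fun k l : ι => Real.exp (M k l)).PosSemidef := posSemidef_entrywiseExp (posSemidef_reflectGram ν hm s hs f)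
  have hq := hPSD.dotProduct_mulVec_nonneg (fun k => a k * Real.exp (V k / 2))
  have e : star (fun k => a k * Real.exp (V k / 2)) ⬝ᵥ (Matrix.of (fun k l : ι => Real.exp (M k l))).mulVec (fun k => a k * Real.exp (V k / 2))
      = ∑ k, ∑ l, (a k * Real.exp (V k / 2)) * Real.exp (M k l) * (a l * Real.exp (V l / 2)) := by
    simp only [star_trivial, dotProduct, Matrix.mulVec, Matrix.of_apply, Finset.mul_sum]
    refine Finset.sum_congr rfl fun k _ => Finset.sum_congr rfl fun l _ => ?_
    ring
  rw [e] at hq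
  exact hq

end RP

end Summit.QuantumFields.YangMills.BalabanUVNodes.N15KingModelRung.InfiniteVolume
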